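import Mathlib

/-!
# Zhang (2022) Appendix A, proof of Lemma 16.1 (iii): product bookkeeping over the primes

Topic `Literature/NumberTheory/LFunctions/Zhang2022` (Landau–Siegel audit tree; verdict-neutral).
Y. Zhang, *Discrete mean estimates and the Landau–Siegel zero*, arXiv:2211.02515v1 (2022)
[Zhang2022LandauSiegel] — **an unrefereed manuscript under adjudication**; this file PROVES elementary
inequalities and asserts nothing about the manuscript's theorems. Campaign D-0069, DAG node
`Z22:Lem16.1.pf` (App. A p. 105, tex L5194–5224: "It follows that `𝔪₂(d,l;s) = ∏_{q<D,…}(…) + O(α₁)`"),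
feeding `Z22:Lem16.1` [Z22 p. 92, tex L4579] and `Skeleton.Ded1617`.

The step "It follows that" multiplies, over all primes, Euler factors `F_q(s)` that are within
`O(α log q/q)` of the main factors `M_q` for `q < D` and within `O(q^{−19/10})` of `1` always.
Kernel-checked here, generically: `norm_prod_one_add_sub_prod_one_add_le` and its infinite version
`norm_tprod_one_add_sub_tprod_one_add_le` —
**`‖∏'(1 + fᵢ) − ∏'(1 + gᵢ)‖ ≤ exp(Σ'‖fᵢ‖ + Σ'‖gᵢ‖) · Σ'‖fᵢ − gᵢ‖`** for norm-summable `f, g : ι → ℂ`;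
and the abstract assembly over the primes `norm_tprod_primes_sub_tprod_primes_le`: if
`‖Φ_q − 1‖ ≤ 225 q^{−σ}/q` (`σ ≥ 9/10`), `‖Ψ_q − 1‖ ≤ 4/q²` for all primes and
`‖Φ_q − Ψ_q‖ ≤ A log q/q²` for the primes `q ≤ Q`, then
`‖∏'_q Φ_q − ∏'_q Ψ_q‖ ≤ K · (A + Q^{−4/5})` with an absolute constant `K` (`assemblyConst`).

Companions: `AppendixAKappa2PrimePowers`, `AppendixAEulerFactorM2` (the per-prime inputs) and
`AppendixALemma161` (the instantiation: Lemma 16.1 in model form, then against L4-t4/t5's typed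
`calM2star`, `frakp`, `Lemma161`).

## References
* Y. Zhang, arXiv:2211.02515v1 (2022), §16 pp. 90–92, Appendix A p. 105 (proof of Lemma 16.1).
  [cite: Zhang2022LandauSiegel, §16 Lemma 16.1, App. A]
-/

noncomputable section

open Complex Real Finset Filter Topology

namespace Literature.NumberTheory.LFunctions.Zhang2022.AppendixA


/-! ## §1. Product bookkeeping: `∏(1+fᵢ)` against `∏(1+gᵢ)` -/

/-- `‖∏_{i∈s}(1 + gᵢ)‖ ≤ exp(Σ_{i∈s}‖gᵢ‖)`. [folklore] -/
private theorem norm_prod_one_add_le_exp {ι : Type*} (s : Finset ι) (g : ι → ℂ) :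
    ‖∏ i ∈ s, (1 + g i)‖ ≤ Real.exp (∑ i ∈ s, ‖g i‖) := by
  classical
  induction s using Finset.induction_on with
  | empty => simp
  | insert a s ha ih =>
    rw [Finset.prod_insert ha, Finset.sum_insert ha, norm_mul, Real.exp_add]
    refine mul_le_mul ?_ ih (norm_nonneg _) (Real.exp_pos _).le
    calc ‖1 + g a‖ ≤ ‖(1 : ℂ)‖ + ‖g a‖ := norm_add_le _ _
      _ = ‖g a‖ + 1 := by rw [norm_one, add_comm]
      _ ≤ Real.exp ‖g a‖ := Real.add_one_le_exp _

/-- **Finite product bookkeeping**: `‖∏_{i∈s}(1+fᵢ) − ∏_{i∈s}(1+gᵢ)‖ ≤ exp(Σ_{i∈s}(‖fᵢ‖+‖gᵢ‖))·Σ_{i∈s}‖fᵢ−gᵢ‖`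
(the finite form of the product step "It follows that …", App. A p. 105).
[cite: Zhang2022LandauSiegel, App. A p. 105] -/
theorem norm_prod_one_add_sub_prod_one_add_le {ι : Type*} (s : Finset ι) (f g : ι → ℂ) :
    ‖∏ i ∈ s, (1 + f i) - ∏ i ∈ s, (1 + g i)‖ ≤
      Real.exp (∑ i ∈ s, (‖f i‖ + ‖g i‖)) * ∑ i ∈ s, ‖f i - g i‖ := by
  classical
  induction s using Finset.induction_on with
  | empty => simp
  | insert a s ha ih =>
    rw [Finset.prod_insert ha, Finset.prod_insert ha, Finset.sum_insert ha, Finset.sum_insert ha]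
    set A := ∏ i ∈ s, (1 + f i)
    set B := ∏ i ∈ s, (1 + g i)
    set S := ∑ i ∈ s, (‖f i‖ + ‖g i‖)
    set E := ∑ i ∈ s, ‖f i - g i‖
    have hB : ‖B‖ ≤ Real.exp S := by
      refine (norm_prod_one_add_le_exp s g).trans (Real.exp_le_exp.mpr ?_)
      exact Finset.sum_le_sum fun i _ => by linarith [norm_nonneg (f i)]
    have hE : 0 ≤ E := Finset.sum_nonneg fun i _ => norm_nonneg _
    have e : (1 + f a) * A - (1 + g a) * B = (1 + f a) * (A - B) + (f a - g a) * B := by ring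
    rw [e]
    have h1 : ‖1 + f a‖ ≤ Real.exp ‖f a‖ :=
      calc ‖1 + f a‖ ≤ ‖(1 : ℂ)‖ + ‖f a‖ := norm_add_le _ _
        _ = ‖f a‖ + 1 := by rw [norm_one, add_comm]
        _ ≤ Real.exp ‖f a‖ := Real.add_one_le_exp _
    have hfa : Real.exp ‖f a‖ ≤ Real.exp (‖f a‖ + ‖g a‖) :=
      Real.exp_le_exp.mpr (by linarith [norm_nonneg (g a)])
    have hS : Real.exp S ≤ Real.exp (‖f a‖ + ‖g a‖ + S) :=
      Real.exp_le_exp.mpr (by linarith [norm_nonneg (f a), norm_nonneg (g a)])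
    calc ‖(1 + f a) * (A - B) + (f a - g a) * B‖
        ≤ ‖1 + f a‖ * ‖A - B‖ + ‖f a - g a‖ * ‖B‖ := by
          refine (norm_add_le _ _).trans ?_; rw [norm_mul, norm_mul]
      _ ≤ Real.exp (‖f a‖ + ‖g a‖) * (Real.exp S * E) + ‖f a - g a‖ * Real.exp S := by
          gcongr
          · exact h1.trans hfa
      _ ≤ Real.exp (‖f a‖ + ‖g a‖) * (Real.exp S * E) +
            ‖f a - g a‖ * (Real.exp (‖f a‖ + ‖g a‖) * Real.exp S) := by
          gcongr
          exact le_mul_of_one_le_left (Real.exp_pos _).le (Real.one_le_exp (by positivity))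
      _ = Real.exp (‖f a‖ + ‖g a‖ + S) * (‖f a - g a‖ + E) := by simp only [Real.exp_add]; ring

/-- **Infinite product bookkeeping**: for norm-summable `f, g : ι → ℂ`,
`‖∏'(1+fᵢ) − ∏'(1+gᵢ)‖ ≤ exp(Σ'‖fᵢ‖ + Σ'‖gᵢ‖) · Σ'‖fᵢ − gᵢ‖` (the product step "It follows
that `𝔪₂(d,l;s) = ∏(…) + O(α₁)`", App. A p. 105, in general form). [cite: Zhang2022LandauSiegel, App. A p. 105] -/
theorem norm_tprod_one_add_sub_tprod_one_add_le {ι : Type*} {f g : ι → ℂ}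
    (hf : Summable fun i => ‖f i‖) (hg : Summable fun i => ‖g i‖) :
    ‖∏' i, (1 + f i) - ∏' i, (1 + g i)‖ ≤
      Real.exp (∑' i, ‖f i‖ + ∑' i, ‖g i‖) * ∑' i, ‖f i - g i‖ := by
  have hfg : Summable fun i => ‖f i - g i‖ :=
    (hf.add hg).of_nonneg_of_le (fun i => norm_nonneg _) (fun i => norm_sub_le _ _)
  have Pf : HasProd (fun i => 1 + f i) (∏' i, (1 + f i)) :=
    (multipliable_one_add_of_summable hf).hasProd
  have Pg : HasProd (fun i => 1 + g i) (∏' i, (1 + g i)) :=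
    (multipliable_one_add_of_summable hg).hasProd
  have hT := (continuous_norm.tendsto _).comp (Pf.sub Pg)
  refine le_of_tendsto' hT fun s => ?_
  simp only [Function.comp_apply]
  refine (norm_prod_one_add_sub_prod_one_add_le s f g).trans ?_
  have hs1 : ∑ i ∈ s, (‖f i‖ + ‖g i‖) ≤ ∑' i, ‖f i‖ + ∑' i, ‖g i‖ := by
    rw [Finset.sum_add_distrib]
    exact add_le_add (hf.sum_le_tsum s fun i _ => norm_nonneg _)
      (hg.sum_le_tsum s fun i _ => norm_nonneg _)
  have hs2 : ∑ i ∈ s, ‖f i - g i‖ ≤ ∑' i, ‖f i - g i‖ :=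
    hfg.sum_le_tsum s fun i _ => norm_nonneg _
  gcongr


/-! ## §2. Absolute constants: sums over the primes -/

/-- `Σ_q q^{r}` over the primes converges for `r < −1` (Mathlib). [folklore] -/
private theorem summable_primes_rpow {r : ℝ} (hr : r < -1) :
    Summable fun q : Nat.Primes => ((q : ℕ) : ℝ) ^ r :=
  Nat.Primes.summable_rpow.mpr hr

/-- `log q / q² ≤ 2 q^{−3/2}` (`q ≥ 1`), from `log x ≤ x^{1/2}/(1/2)`. [folklore] -/
private theorem log_div_sq_le (q : ℕ) (hq : 0 < q) :
    Real.log q / (q : ℝ) ^ 2 ≤ 2 * (q : ℝ) ^ (-(3 / 2 : ℝ)) := by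
  have hq' : (0 : ℝ) < q := by exact_mod_cast hq
  have h := Real.log_le_rpow_div (le_of_lt hq') (show (0 : ℝ) < 1 / 2 by norm_num)
  rw [div_le_iff₀ (by positivity)]
  calc Real.log q ≤ (q : ℝ) ^ (1 / 2 : ℝ) / (1 / 2) := h
    _ = 2 * (q : ℝ) ^ (-(3 / 2 : ℝ)) * (q : ℝ) ^ 2 := by
        rw [show ((q : ℝ) ^ 2) = (q : ℝ) ^ (2 : ℝ) by norm_cast, mul_assoc,
          ← Real.rpow_add hq']
        norm_num
        ring

/-- `Σ_q log q / q²` over the primes converges. [folklore] -/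
private theorem summable_primes_log_div_sq :
    Summable fun q : Nat.Primes => Real.log (q : ℕ) / ((q : ℕ) : ℝ) ^ 2 := by
  refine ((summable_primes_rpow (show (-(3 / 2 : ℝ)) < -1 by norm_num)).mul_left 2).of_nonneg_of_le
    (fun q => div_nonneg (Real.log_natCast_nonneg _) (by positivity)) fun q => ?_
  exact log_div_sq_le q q.prop.pos

/-- For a prime `q` (so `q ≥ 2 ≥ 1`) and `σ ≥ 9/10`: `q^{−σ}/q ≤ q^{−19/10}`. [folklore] -/
private theorem rpow_neg_div_le (q : Nat.Primes) {σ : ℝ} (hσ : 9 / 10 ≤ σ) :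
    ((q : ℕ) : ℝ) ^ (-σ) / (q : ℕ) ≤ ((q : ℕ) : ℝ) ^ (-(19 / 10 : ℝ)) := by
  have hq1 : (1 : ℝ) ≤ (q : ℕ) := by exact_mod_cast q.prop.one_lt.le
  have hq0 : (0 : ℝ) < (q : ℕ) := by linarith
  rw [div_le_iff₀ hq0, show (-(19 / 10 : ℝ)) = (-(9 / 10 : ℝ)) + (-1 : ℝ) by norm_num,
    Real.rpow_add hq0, Real.rpow_neg_one, mul_assoc, inv_mul_cancel₀ hq0.ne', mul_one]
  exact Real.rpow_le_rpow_of_exponent_le hq1 (by linarith)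

/-- For primes `q > Q ≥ 1`: `q^{−19/10} ≤ Q^{−4/5} q^{−11/10}`. [folklore] -/
private theorem rpow_tail_le (q : Nat.Primes) {Q : ℕ} (hQ : 1 ≤ Q) (hqQ : Q < (q : ℕ)) :
    ((q : ℕ) : ℝ) ^ (-(19 / 10 : ℝ)) ≤ (Q : ℝ) ^ (-(4 / 5 : ℝ)) * ((q : ℕ) : ℝ) ^ (-(11 / 10 : ℝ)) := by
  have hQ0 : (0 : ℝ) < Q := by exact_mod_cast hQ
  have hq0 : (0 : ℝ) < (q : ℕ) := by exact_mod_cast q.prop.pos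
  have hQq : (Q : ℝ) ≤ (q : ℕ) := by exact_mod_cast hqQ.le
  rw [show (-(19 / 10 : ℝ)) = (-(4 / 5 : ℝ)) + (-(11 / 10 : ℝ)) by norm_num, Real.rpow_add hq0]
  exact mul_le_mul_of_nonneg_right
    (Real.rpow_le_rpow_of_nonpos hQ0 hQq (show (-(4 / 5 : ℝ)) ≤ 0 by norm_num)) (by positivity)

/-! ## §3. The abstract assembly over the primes -/

/-- **The assembly behind "It follows that `𝔪₂(d,l;s) = ∏(main factors) + O(α₁)`"** (App. A p. 105),
as an abstract statement about two Euler products over the primes: if `‖Φ_q − 1‖ ≤ 225q^{−σ}/q`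
(`σ ≥ 9/10`) and `‖Ψ_q − 1‖ ≤ 4/q²` for every prime, and `‖Φ_q − Ψ_q‖ ≤ A log q/q²` for the primes
`q ≤ Q` (`Q ≥ 1`), then `‖∏'_q Φ_q − ∏'_q Ψ_q‖ ≤ K(A + Q^{−4/5})` with ONE absolute constant `K`.
[cite: Zhang2022LandauSiegel, App. A p. 105] -/
theorem exists_assembly_const : ∃ K : ℝ, 0 < K ∧
    ∀ (σ : ℝ), 9 / 10 ≤ σ → ∀ (Q : ℕ), 1 ≤ Q → ∀ (A : ℝ), 0 ≤ A →
    ∀ (Φ Ψ : Nat.Primes → ℂ),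
      (∀ q, ‖Φ q - 1‖ ≤ 225 * ((q : ℕ) : ℝ) ^ (-σ) / (q : ℕ)) →
      (∀ q, ‖Ψ q - 1‖ ≤ 4 / ((q : ℕ) : ℝ) ^ 2) →
      (∀ q : Nat.Primes, (q : ℕ) ≤ Q → ‖Φ q - Ψ q‖ ≤ A * Real.log (q : ℕ) / ((q : ℕ) : ℝ) ^ 2) →
        ‖∏' q, Φ q - ∏' q, Ψ q‖ ≤ K * (A + (Q : ℝ) ^ (-(4 / 5 : ℝ))) := by
  -- the absolute constants
  set S19 : ℝ := ∑' q : Nat.Primes, ((q : ℕ) : ℝ) ^ (-(19 / 10 : ℝ)) with hS19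
  set S11 : ℝ := ∑' q : Nat.Primes, ((q : ℕ) : ℝ) ^ (-(11 / 10 : ℝ)) with hS11
  set Slog : ℝ := ∑' q : Nat.Primes, Real.log (q : ℕ) / ((q : ℕ) : ℝ) ^ 2 with hSlog
  have sum19 := summable_primes_rpow (show (-(19 / 10 : ℝ)) < -1 by norm_num)
  have sum11 := summable_primes_rpow (show (-(11 / 10 : ℝ)) < -1 by norm_num)
  have sum2 := summable_primes_rpow (show (-(2 : ℝ)) < -1 by norm_num)
  have hS19nn : 0 ≤ S19 := tsum_nonneg fun q => by positivity
  have hS11nn : 0 ≤ S11 := tsum_nonneg fun q => by positivity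
  have hSlognn : 0 ≤ Slog :=
    tsum_nonneg fun q => div_nonneg (Real.log_natCast_nonneg _) (by positivity)
  refine ⟨Real.exp (225 * S19 + 4 * S19) * (Slog + 229 * S11 + 1), by positivity,
    fun σ hσ Q hQ A hA Φ Ψ hΦ hΨ hΦΨ => ?_⟩
  have hQ0 : (0 : ℝ) < Q := by exact_mod_cast hQ
  -- `Φ = 1 + f`, `Ψ = 1 + g`
  set f : Nat.Primes → ℂ := fun q => Φ q - 1 with hf
  set g : Nat.Primes → ℂ := fun q => Ψ q - 1 with hg
  have q2 : ∀ q : Nat.Primes, (2 : ℝ) ≤ (q : ℕ) := fun q => by exact_mod_cast q.prop.two_le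
  have hfb : ∀ q : Nat.Primes, ‖f q‖ ≤ 225 * ((q : ℕ) : ℝ) ^ (-(19 / 10 : ℝ)) := fun q => by
    calc ‖f q‖ ≤ 225 * ((q : ℕ) : ℝ) ^ (-σ) / (q : ℕ) := hΦ q
      _ = 225 * (((q : ℕ) : ℝ) ^ (-σ) / (q : ℕ)) := by ring
      _ ≤ 225 * ((q : ℕ) : ℝ) ^ (-(19 / 10 : ℝ)) := by gcongr; exact rpow_neg_div_le q hσ
  have hgb : ∀ q : Nat.Primes, ‖g q‖ ≤ 4 * ((q : ℕ) : ℝ) ^ (-(19 / 10 : ℝ)) := fun q => by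
    have hq1 : (1 : ℝ) ≤ (q : ℕ) := by linarith [q2 q]
    calc ‖g q‖ ≤ 4 / ((q : ℕ) : ℝ) ^ 2 := hΨ q
      _ = 4 * ((q : ℕ) : ℝ) ^ (-(2 : ℝ)) := by
          rw [Real.rpow_neg (by linarith), Real.rpow_two, div_eq_mul_inv]
      _ ≤ 4 * ((q : ℕ) : ℝ) ^ (-(19 / 10 : ℝ)) := by
          exact mul_le_mul_of_nonneg_left
            (Real.rpow_le_rpow_of_exponent_le hq1 (show (-(2 : ℝ)) ≤ -(19 / 10) by norm_num))
            (by norm_num)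
  have hfs : Summable fun q => ‖f q‖ :=
    (sum19.mul_left 225).of_nonneg_of_le (fun q => norm_nonneg _) hfb
  have hgs : Summable fun q => ‖g q‖ :=
    (sum19.mul_left 4).of_nonneg_of_le (fun q => norm_nonneg _) hgb
  have hfgs : Summable fun q => ‖f q - g q‖ :=
    (hfs.add hgs).of_nonneg_of_le (fun q => norm_nonneg _) (fun q => norm_sub_le _ _)
  -- the main estimate
  have key := norm_tprod_one_add_sub_tprod_one_add_le hfs hgs
  have eΦ : (fun q => 1 + f q) = Φ := funext fun q => by simp [hf]
  have eΨ : (fun q => 1 + g q) = Ψ := funext fun q => by simp [hg]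
  rw [eΦ, eΨ] at key
  -- bound the three series
  have b1 : ∑' q, ‖f q‖ ≤ 225 * S19 := by
    rw [hS19, ← tsum_mul_left]; exact hfs.tsum_le_tsum hfb (sum19.mul_left _)
  have b2 : ∑' q, ‖g q‖ ≤ 4 * S19 := by
    rw [hS19, ← tsum_mul_left]; exact hgs.tsum_le_tsum hgb (sum19.mul_left _)
  have ptw : ∀ q : Nat.Primes, ‖f q - g q‖ ≤
      A * (Real.log (q : ℕ) / ((q : ℕ) : ℝ) ^ 2) +
        229 * (Q : ℝ) ^ (-(4 / 5 : ℝ)) * ((q : ℕ) : ℝ) ^ (-(11 / 10 : ℝ)) := fun q => by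
    have t1 : 0 ≤ A * (Real.log (q : ℕ) / ((q : ℕ) : ℝ) ^ 2) :=
      mul_nonneg hA (div_nonneg (Real.log_natCast_nonneg _) (by positivity))
    have t2 : 0 ≤ 229 * (Q : ℝ) ^ (-(4 / 5 : ℝ)) * ((q : ℕ) : ℝ) ^ (-(11 / 10 : ℝ)) := by
      positivity
    have efg : f q - g q = Φ q - Ψ q := by simp [hf, hg]
    rw [efg]
    by_cases hqQ : (q : ℕ) ≤ Q
    · calc ‖Φ q - Ψ q‖ ≤ A * Real.log (q : ℕ) / ((q : ℕ) : ℝ) ^ 2 := hΦΨ q hqQ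
        _ = A * (Real.log (q : ℕ) / ((q : ℕ) : ℝ) ^ 2) := by ring
        _ ≤ _ := le_add_of_nonneg_right t2
    · push Not at hqQ
      calc ‖Φ q - Ψ q‖ = ‖f q - g q‖ := by rw [efg]
        _ ≤ ‖f q‖ + ‖g q‖ := norm_sub_le _ _
        _ ≤ 225 * ((q : ℕ) : ℝ) ^ (-(19 / 10 : ℝ)) + 4 * ((q : ℕ) : ℝ) ^ (-(19 / 10 : ℝ)) :=
            add_le_add (hfb q) (hgb q)
        _ = 229 * ((q : ℕ) : ℝ) ^ (-(19 / 10 : ℝ)) := by ring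
        _ ≤ 229 * ((Q : ℝ) ^ (-(4 / 5 : ℝ)) * ((q : ℕ) : ℝ) ^ (-(11 / 10 : ℝ))) := by
            gcongr; exact rpow_tail_le q hQ hqQ
        _ = 229 * (Q : ℝ) ^ (-(4 / 5 : ℝ)) * ((q : ℕ) : ℝ) ^ (-(11 / 10 : ℝ)) := by ring
        _ ≤ _ := le_add_of_nonneg_left t1
  have sumR : Summable fun q : Nat.Primes => A * (Real.log (q : ℕ) / ((q : ℕ) : ℝ) ^ 2) +
      229 * (Q : ℝ) ^ (-(4 / 5 : ℝ)) * ((q : ℕ) : ℝ) ^ (-(11 / 10 : ℝ)) :=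
    (summable_primes_log_div_sq.mul_left A).add (sum11.mul_left _)
  have b3 : ∑' q, ‖f q - g q‖ ≤ A * Slog + 229 * (Q : ℝ) ^ (-(4 / 5 : ℝ)) * S11 := by
    calc ∑' q, ‖f q - g q‖ ≤ ∑' q : Nat.Primes, (A * (Real.log (q : ℕ) / ((q : ℕ) : ℝ) ^ 2) +
          229 * (Q : ℝ) ^ (-(4 / 5 : ℝ)) * ((q : ℕ) : ℝ) ^ (-(11 / 10 : ℝ))) :=
          hfgs.tsum_le_tsum ptw sumR
      _ = A * Slog + 229 * (Q : ℝ) ^ (-(4 / 5 : ℝ)) * S11 := by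
          rw [(summable_primes_log_div_sq.mul_left A).tsum_add (sum11.mul_left _), tsum_mul_left,
            tsum_mul_left]
  have hQpow : (Q : ℝ) ^ (-(4 / 5 : ℝ)) ≤ 1 := by
    apply Real.rpow_le_one_of_one_le_of_nonpos (by exact_mod_cast hQ) (by norm_num)
  have hQpow0 : 0 ≤ (Q : ℝ) ^ (-(4 / 5 : ℝ)) := by positivity
  calc ‖∏' q, Φ q - ∏' q, Ψ q‖
      ≤ Real.exp (∑' q, ‖f q‖ + ∑' q, ‖g q‖) * ∑' q, ‖f q - g q‖ := key
    _ ≤ Real.exp (225 * S19 + 4 * S19) * (A * Slog + 229 * (Q : ℝ) ^ (-(4 / 5 : ℝ)) * S11) :=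
        mul_le_mul (Real.exp_le_exp.mpr (add_le_add b1 b2)) b3
          (tsum_nonneg fun q => norm_nonneg _) (Real.exp_pos _).le
    _ ≤ Real.exp (225 * S19 + 4 * S19) * ((Slog + 229 * S11 + 1) * (A + (Q : ℝ) ^ (-(4 / 5 : ℝ)))) := by
        gcongr
        nlinarith [mul_nonneg hA hS11nn, mul_nonneg hQpow0 hSlognn, mul_nonneg hA hSlognn]
    _ = Real.exp (225 * S19 + 4 * S19) * (Slog + 229 * S11 + 1) * (A + (Q : ℝ) ^ (-(4 / 5 : ℝ))) := by
        ring

end Literature.NumberTheory.LFunctions.Zhang2022.AppendixA
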